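import Summits.RiemannHypothesis.RiemannHypothesis.Theorems.SemilocalDeletionProductCombs
import Summits.RiemannHypothesis.RiemannHypothesis.Theorems.SemilocalDeletionToeplitzBandEdgeCombs
import HarnessLib

/-!
# Separated product combs EXIST; the joint deletion form attains `−Σ_p F̌_p(m_p)` exactly

Sequel of `SemilocalDeletionProductCombs` (exact additivity of deletion costs on product combs, under a `δ`-separation hypothesis) and
`SemilocalDeletionToeplitzBandEdgeCombs` (the one-prime alternating sine comb `X_p` with `X_pᵀA_{m}(p)X_p = −F̌_p(m)|X_p|²`).

* §1 `exists_pos_forall_lt_abs`: a finite set of reals stays `2δ` away from `0` off `0`; hence (`exists_separation_box`) for every finite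
  set of primes `T`, box `k_p ≤ m_p` and lag bound `E` there is `δ > 0` such that every difference `x_k − x_{k'} − e·log p`
  (`k, k'` in the box, `p ∈ T`, `e ≤ E`) is `0` or exceeds `2δ` in modulus — the separation hypothesis of the product-comb file.
* §2 ★ `exists_sdiff_sub_eq_neg_sum_bandEdgeComb`: for finite sets `T ⊆ S`, `T` primes, and any `m : ℕ → ℕ` there are `δ > 0` and a
  Weil test function `g ≠ 0` supported in `[−(C+δ), C+δ]`, `C = Σ_{p∈T} m_p log p/2`, with
  `Re Q_{S∖T}(g) − Re Q_S(g) = −(Σ_{p∈T} F̌_p(m_p))·‖g‖₂²`,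
  `F̌_p(m) = 2·log p·(1 + c_m√p − ε_m)/(p + 2c_m√p + 1 − ε_m)`, `c_m = cos(π/(m+2))`, `ε_m = 2sin²(π/(m+2))/(m+2)`.

So on the window of half-width `Σ_p m_p log p/2 + δ` the joint deletion of `T` can cost `Σ_p F̌_p(m_p)` per unit norm, while
(`SemilocalDeletionToeplitzBandEdgeDeficit.semilocalGroundEnergy_sdiff_ge_window`) it never costs more than `Σ_p [F_p − K_p/(c + log p)²]`:
with `F_p − F̌_p(m) ≍ (log p)·m⁻²` both ends sit `O(b⁻²)` below the additive all-window limit `Σ_p F_p` — the joint lag floor converges to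
`Σ_p 2·log p/(√p+1)` like `b⁻²` and the floor-level prime–prime interaction dies at that rate, for EVERY finite set of primes
(HOME/cc-s2-1/gen17/ANIMAL-SUPREMUM.md §9, EXPLORATORY → theorem).  Nothing here bears on RH; truncated Weil forms only.
-/

set_option linter.dupNamespace false

noncomputable section

open Complex Filter Set MeasureTheory
open scoped Real Topology ComplexConjugate

namespace Summit.RiemannHypothesis.RiemannHypothesis.Theorems.SemilocalDeletionProductCombsExist

open Literature.NumberTheory.LFunctions
open Summit.RiemannHypothesis.RiemannHypothesis.Theorems.SemilocalDeletionAnimalCombs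
open Summit.RiemannHypothesis.RiemannHypothesis.Theorems.SemilocalDeletionProductCombs
open Summit.RiemannHypothesis.RiemannHypothesis.Theorems.SemilocalDeletionToeplitzBandEdgeCombs
open Summit.RiemannHypothesis.RiemannHypothesis.Theorems.HandoffSemilocalEnergy

/-! ## §1  Separation -/

/-- A finite set of reals is bounded away from `0` off `0`: `∃ δ > 0, ∀ v ∈ V, v ≠ 0 → 2δ < |v|`. -/
theorem exists_pos_forall_lt_abs (V : Finset ℝ) : ∃ δ : ℝ, 0 < δ ∧ ∀ v ∈ V, v ≠ 0 → 2 * δ < |v| := by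
  classical
  set W := (V.filter (· ≠ 0)).image (fun v : ℝ ↦ |v|) with hW
  by_cases hne : W.Nonempty
  · have hpos : 0 < W.min' hne := by
      obtain ⟨v, hv, hv'⟩ := Finset.mem_image.mp (W.min'_mem hne)
      rw [← hv']
      exact abs_pos.mpr (Finset.mem_filter.mp hv).2
    refine ⟨W.min' hne / 3, by positivity, fun v hv hv0 ↦ ?_⟩
    have hmem : |v| ∈ W := Finset.mem_image.mpr ⟨v, Finset.mem_filter.mpr ⟨hv, hv0⟩, rfl⟩
    have := W.min'_le _ hmem
    linarith
  · refine ⟨1, one_pos, fun v hv hv0 ↦ ?_⟩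
    exact absurd ⟨|v|, Finset.mem_image.mpr ⟨v, Finset.mem_filter.mpr ⟨hv, hv0⟩, rfl⟩⟩ hne

variable {T : Finset ℕ} {m : ℕ → ℕ}

/-- **Separation of the product configuration.** For a finite set `T` of primes, a box `k_p ≤ m_p`, a shift `C` and a lag bound `E`
there is `δ > 0` such that `x_k − x_{k'} − e·log p₀` (`x_k = Σ_p k_p log p − C`; `k, k'` in the box, `p₀ ∈ T`, `e ≤ E`) is either `0`
or `> 2δ` in modulus, and distinct teeth are `> 2δ` apart. -/
theorem exists_separation_box (T : Finset ℕ) (m : ℕ → ℕ) (C : ℝ) (E : ℕ) :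
    ∃ δ : ℝ, 0 < δ ∧
      (∀ k ∈ Fintype.piFinset (fun p : T ↦ Finset.range (m p + 1)), ∀ k' ∈ Fintype.piFinset (fun p : T ↦ Finset.range (m p + 1)),
        ∀ p₀ : T, ∀ e ≤ E,
          (∑ p : T, (k p : ℝ) * Real.log (p : ℕ) - C) - (∑ p : T, (k' p : ℝ) * Real.log (p : ℕ) - C) ≠ e * Real.log (p₀ : ℕ) →
          2 * δ < |(∑ p : T, (k p : ℝ) * Real.log (p : ℕ) - C) - (∑ p : T, (k' p : ℝ) * Real.log (p : ℕ) - C) -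
            e * Real.log (p₀ : ℕ)|) ∧
      (∀ k ∈ Fintype.piFinset (fun p : T ↦ Finset.range (m p + 1)), ∀ k' ∈ Fintype.piFinset (fun p : T ↦ Finset.range (m p + 1)),
          (∑ p : T, (k p : ℝ) * Real.log (p : ℕ) - C) - (∑ p : T, (k' p : ℝ) * Real.log (p : ℕ) - C) ≠ 0 →
          2 * δ < |(∑ p : T, (k p : ℝ) * Real.log (p : ℕ) - C) - (∑ p : T, (k' p : ℝ) * Real.log (p : ℕ) - C)|) := by
  classical
  set box := Fintype.piFinset (fun p : T ↦ Finset.range (m p + 1)) with hbox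
  set pos : (T → ℕ) → ℝ := fun k ↦ ∑ p : T, (k p : ℝ) * Real.log (p : ℕ) - C with hpos
  -- all the differences, with and without lags
  set V : Finset ℝ := ((box ×ˢ box) ×ˢ ((Finset.univ : Finset T) ×ˢ Finset.range (E + 1))).image
      (fun q ↦ pos q.1.1 - pos q.1.2 - q.2.2 * Real.log (q.2.1 : ℕ)) ∪ (box ×ˢ box).image (fun q ↦ pos q.1 - pos q.2) with hV
  obtain ⟨δ, hδ, hV'⟩ := exists_pos_forall_lt_abs V
  refine ⟨δ, hδ, fun k hk k' hk' p₀ e he hne ↦ ?_, fun k hk k' hk' hne ↦ ?_⟩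
  · have hmem : pos k - pos k' - e * Real.log (p₀ : ℕ) ∈ V := by
      rw [hV, Finset.mem_union]; left
      exact Finset.mem_image.mpr ⟨((k, k'), (p₀, e)), Finset.mem_product.mpr ⟨Finset.mem_product.mpr ⟨hk, hk'⟩,
        Finset.mem_product.mpr ⟨Finset.mem_univ _, Finset.mem_range.mpr (Nat.lt_succ_of_le he)⟩⟩, rfl⟩
    exact hV' _ hmem (sub_ne_zero.mpr hne)
  · have hmem : pos k - pos k' ∈ V := by
      rw [hV, Finset.mem_union]; right
      exact Finset.mem_image.mpr ⟨(k, k'), Finset.mem_product.mpr ⟨hk, hk'⟩, rfl⟩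
    exact hV' _ hmem hne

/-! ## §2  The product of band-edge combs -/

/-- Truncation: if `X(i) = 0` for `i > m` and `m ≤ E` then the one-prime lag form over `d < E` equals the one over `d < m`
(terms `d ≥ m` vanish), with the factors in either order. -/
theorem lagForm_truncate {X : ℕ → ℝ} {w : ℕ → ℝ} {m E : ℕ} (hX : ∀ i, m < i → X i = 0) (hmE : m ≤ E) :
    ∑ d ∈ Finset.range E, w d * ∑ i ∈ Finset.range (m + 1), X (i + (d + 1)) * X i =
      ∑ d ∈ Finset.range m, w d * ∑ i ∈ Finset.range (m + 1), X i * X (i + (d + 1)) := by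
  rw [← Finset.sum_range_add_sum_Ico _ hmE]
  have hzero : ∑ d ∈ Finset.Ico m E, w d * ∑ i ∈ Finset.range (m + 1), X (i + (d + 1)) * X i = 0 := by
    refine Finset.sum_eq_zero fun d hd ↦ ?_
    rw [Finset.sum_eq_zero fun i _ ↦ by rw [hX _ (by have := (Finset.mem_Ico.mp hd).1; omega), zero_mul], mul_zero]
  rw [hzero, add_zero]
  exact Finset.sum_congr rfl fun d _ ↦ by congr 1; exact Finset.sum_congr rfl fun i _ ↦ mul_comm _ _

/-- **★ THE JOINT DELETION FORM ATTAINS `−Σ_p F̌_p(m_p)`.** For finite sets `T ⊆ S` with `T` primes and any `m : ℕ → ℕ` there are `δ > 0`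
and a Weil test function `g ≠ 0` on the window `[−(C+δ), C+δ]`, `C = Σ_{p∈T} m_p·log p/2` (the product of the band-edge sine combs), with
`Re Q_{S∖T}(g) − Re Q_S(g) = −(Σ_{p∈T} F̌_p(m_p))·‖g‖₂²` EXACTLY. -/
theorem exists_sdiff_sub_eq_neg_sum_bandEdgeComb {S T : Finset ℕ} (hTS : T ⊆ S) (hT : ∀ p ∈ T, p.Prime) (m : ℕ → ℕ) :
    ∃ δ : ℝ, 0 < δ ∧ ∃ g : ℝ → ℂ, IsWeilTest g ∧
      tsupport g ⊆ Icc (-((∑ p ∈ T, (m p : ℝ) * Real.log p) / 2 + δ)) ((∑ p ∈ T, (m p : ℝ) * Real.log p) / 2 + δ) ∧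
      0 < ∫ u : ℝ, ‖g u‖ ^ 2 ∧
      (weilSemilocalQuadratic (S \ T) g).re - (weilSemilocalQuadratic S g).re =
        -(∑ p ∈ T, 2 * Real.log p * (1 + Real.cos (π / (m p + 2)) * Real.sqrt p - 2 * Real.sin (π / (m p + 2)) ^ 2 / (m p + 2)) /
            (p + 2 * Real.cos (π / (m p + 2)) * Real.sqrt p + 1 - 2 * Real.sin (π / (m p + 2)) ^ 2 / (m p + 2))) *
          ∫ u : ℝ, ‖g u‖ ^ 2 := by
  classical
  -- the one-prime band-edge combs
  have hXex : ∀ p : ℕ, p.Prime → ∃ X : ℕ → ℝ, (∀ j, m p < j → X j = 0) ∧ 0 < ∑ i ∈ Finset.range (m p + 1), X i ^ 2 ∧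
      2 * ∑ e ∈ Finset.range (m p), Real.log p / Real.sqrt ((p : ℝ) ^ (e + 1)) *
          ∑ i ∈ Finset.range (m p + 1), X i * X (i + (e + 1)) =
        -(2 * Real.log p * (1 + Real.cos (π / (m p + 2)) * Real.sqrt p - 2 * Real.sin (π / (m p + 2)) ^ 2 / (m p + 2)) /
            (p + 2 * Real.cos (π / (m p + 2)) * Real.sqrt p + 1 - 2 * Real.sin (π / (m p + 2)) ^ 2 / (m p + 2))) *
          ∑ i ∈ Finset.range (m p + 1), X i ^ 2 := fun p hp ↦ exists_bandEdge_comb hp (m p)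
  choose! X hXv hXpos hXform using hXex
  set C : ℝ := (∑ p ∈ T, (m p : ℝ) * Real.log p) / 2 with hCdef
  have hCT : C = (∑ p : T, (m p : ℝ) * Real.log (p : ℕ)) / 2 := by
    rw [hCdef, ← Finset.sum_coe_sort T (fun p ↦ (m p : ℝ) * Real.log p)]
  have hlog2 : 0 < Real.log 2 := Real.log_pos (by norm_num)
  have hC0 : 0 ≤ C := by
    rw [hCdef]
    refine div_nonneg (Finset.sum_nonneg fun p hp ↦ mul_nonneg (Nat.cast_nonneg _) (Real.log_nonneg ?_)) (by norm_num)
    exact_mod_cast (hT p hp).one_lt.le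
  -- lag bound for every δ ≤ 1, then the separation constant, then the actual lag bound
  set E₁ : ℕ := ⌊2 * (C + 1) / Real.log 2⌋₊ with hE₁
  obtain ⟨δ₀, hδ₀, hsep₀, hsep0₀⟩ := exists_separation_box T m C E₁
  set δ : ℝ := min δ₀ 1 with hδdef
  have hδ : 0 < δ := lt_min hδ₀ one_pos
  have hδ1 : δ ≤ 1 := min_le_right _ _
  have hδδ₀ : δ ≤ δ₀ := min_le_left _ _
  set E : ℕ := ⌊2 * (C + δ) / Real.log 2⌋₊ with hEdef
  have hEE₁ : E ≤ E₁ := Nat.floor_le_floor (by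
    exact div_le_div_of_nonneg_right (by linarith) hlog2.le)
  have hE : ∀ p : T, 2 * (C + δ) < (E + 1) * Real.log (p : ℕ) := by
    intro p
    have hp := hT p p.2
    have hlp : Real.log 2 ≤ Real.log (p : ℕ) := Real.log_le_log (by norm_num) (by exact_mod_cast hp.two_le)
    have h1 : 2 * (C + δ) / Real.log 2 < E + 1 := Nat.lt_floor_add_one _
    have h2 : 2 * (C + δ) < (E + 1) * Real.log 2 := by rwa [div_lt_iff₀ hlog2] at h1
    have h3 : (E + 1 : ℝ) * Real.log 2 ≤ (E + 1) * Real.log (p : ℕ) := mul_le_mul_of_nonneg_left hlp (by positivity)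
    linarith
  have hmE : ∀ p : T, m p ≤ E := by
    intro p
    have hp := hT p p.2
    have hlp : Real.log 2 ≤ Real.log (p : ℕ) := Real.log_le_log (by norm_num) (by exact_mod_cast hp.two_le)
    have hlp0 : 0 < Real.log (p : ℕ) := lt_of_lt_of_le hlog2 hlp
    -- `m_p log p ≤ 2C`
    have hle : (m p : ℝ) * Real.log (p : ℕ) ≤ 2 * C := by
      rw [hCT]
      have := Finset.single_le_sum (f := fun q : T ↦ (m q : ℝ) * Real.log (q : ℕ))
        (fun q _ ↦ mul_nonneg (Nat.cast_nonneg _) (Real.log_nonneg (by exact_mod_cast (hT q q.2).one_lt.le))) (Finset.mem_univ p)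
      linarith
    have h1 : (m p : ℝ) < 2 * (C + δ) / Real.log 2 := by
      rw [lt_div_iff₀ hlog2]
      calc (m p : ℝ) * Real.log 2 ≤ (m p : ℝ) * Real.log (p : ℕ) := mul_le_mul_of_nonneg_left hlp (Nat.cast_nonneg _)
        _ ≤ 2 * C := hle
        _ < 2 * (C + δ) := by linarith
    exact Nat.le_floor h1.le
  -- separation at scale `δ ≤ δ₀` for lags `e ≤ E ≤ E₁`
  have hsep : ∀ k ∈ Fintype.piFinset (fun p : T ↦ Finset.range (m p + 1)), ∀ k' ∈ Fintype.piFinset (fun p : T ↦ Finset.range (m p + 1)),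
      ∀ p₀ : T, ∀ e ≤ E, (∑ p : T, (k p : ℝ) * Real.log (p : ℕ) - C) - (∑ p : T, (k' p : ℝ) * Real.log (p : ℕ) - C) ≠
        e * Real.log (p₀ : ℕ) → 2 * δ < |(∑ p : T, (k p : ℝ) * Real.log (p : ℕ) - C) -
          (∑ p : T, (k' p : ℝ) * Real.log (p : ℕ) - C) - e * Real.log (p₀ : ℕ)| :=
    fun k hk k' hk' p₀ e he hne ↦ lt_of_le_of_lt (by linarith) (hsep₀ k hk k' hk' p₀ e (he.trans hEE₁) hne)
  have hsep0 : ∀ k ∈ Fintype.piFinset (fun p : T ↦ Finset.range (m p + 1)), ∀ k' ∈ Fintype.piFinset (fun p : T ↦ Finset.range (m p + 1)),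
      (∑ p : T, (k p : ℝ) * Real.log (p : ℕ) - C) - (∑ p : T, (k' p : ℝ) * Real.log (p : ℕ) - C) ≠ 0 →
        2 * δ < |(∑ p : T, (k p : ℝ) * Real.log (p : ℕ) - C) - (∑ p : T, (k' p : ℝ) * Real.log (p : ℕ) - C)| :=
    fun k hk k' hk' hne ↦ lt_of_le_of_lt (by linarith) (hsep0₀ k hk k' hk' hne)
  -- the block `h ∈ C(δ)` with `‖h‖₂ = 1` and the product comb
  obtain ⟨_, h, hh, hs, -, hn1, -⟩ := semilocalSphereValues_top_nonempty S (a := δ) hδ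
  have hXT : ∀ p ∈ T, ∀ i, m p < i → X p i = 0 := fun p hp i hi ↦ hXv p (hT p hp) i hi
  have hid := weilSemilocalQuadratic_sdiff_sub_prodComb (h := h) (x := fun k : T → ℕ ↦ ∑ p : T, (k p : ℝ) * Real.log (p : ℕ) - C)
    (a := fun k : T → ℕ ↦ ((∏ p : T, X p (k p) : ℝ) : ℂ)) hh hs hT (fun k ↦ rfl) hCT (fun k ↦ rfl) hXT hE hsep hTS
  have hnorm := integral_norm_sq_prodComb (h := h) (x := fun k : T → ℕ ↦ ∑ p : T, (k p : ℝ) * Real.log (p : ℕ) - C)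
    (a := fun k : T → ℕ ↦ ((∏ p : T, X p (k p) : ℝ) : ℂ)) hh hs hT (fun k ↦ rfl) (fun k ↦ rfl) hsep0
  rw [hn1, one_mul] at hnorm
  have hxC : ∀ k ∈ Fintype.piFinset (fun p : T ↦ Finset.range (m p + 1)),
      (fun k : T → ℕ ↦ ∑ p : T, (k p : ℝ) * Real.log (p : ℕ) - C) k ∈ Icc (-(C + δ - δ)) (C + δ - δ) := by
    intro k hk
    have := sum_mul_log_mem_Icc hT hk
    rw [mem_Icc] at this ⊢
    constructor <;> linarith [this.1, this.2]
  have hNpos : 0 < ∏ p : T, ∑ i ∈ Finset.range (m p + 1), X p i ^ 2 :=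
    Finset.prod_pos fun p _ ↦ hXpos p (hT p p.2)
  -- each one-prime term is `−F̌_p(m_p)·|X_p|²·Π_{q≠p}|X_q|² = −F̌_p(m_p)·Π_q|X_q|²`
  set Fc : ℕ → ℝ := fun p ↦ 2 * Real.log p * (1 + Real.cos (π / (m p + 2)) * Real.sqrt p - 2 * Real.sin (π / (m p + 2)) ^ 2 / (m p + 2)) /
    (p + 2 * Real.cos (π / (m p + 2)) * Real.sqrt p + 1 - 2 * Real.sin (π / (m p + 2)) ^ 2 / (m p + 2)) with hFc
  have hterm : ∀ p₀ : T, (2 * ∑ d ∈ Finset.range E, Real.log (p₀ : ℕ) / Real.sqrt (((p₀ : ℕ) : ℝ) ^ (d + 1)) *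
        ∑ i ∈ Finset.range (m p₀ + 1), X p₀ (i + (d + 1)) * X p₀ i) *
      ∏ p ∈ Finset.univ.erase p₀, ∑ i ∈ Finset.range (m p + 1), X p i ^ 2 =
        -(Fc p₀ * ∏ p : T, ∑ i ∈ Finset.range (m p + 1), X p i ^ 2) := by
    intro p₀
    rw [lagForm_truncate (w := fun d ↦ Real.log (p₀ : ℕ) / Real.sqrt (((p₀ : ℕ) : ℝ) ^ (d + 1))) (hXT p₀ p₀.2) (hmE p₀),
      hXform p₀ (hT p₀ p₀.2), ← Finset.mul_prod_erase Finset.univ _ (Finset.mem_univ p₀)]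
    simp only [hFc]
    ring
  refine ⟨δ, hδ, fun t ↦ ∑ k ∈ Fintype.piFinset (fun p : T ↦ Finset.range (m p + 1)),
    ((∏ p : T, X p (k p) : ℝ) : ℂ) * h (t - (∑ p : T, (k p : ℝ) * Real.log (p : ℕ) - C)), isWeilTest_comb hh _ _ _, ?_, ?_, ?_⟩
  · have := tsupport_comb_subset (a := fun k : T → ℕ ↦ ((∏ p : T, X p (k p) : ℝ) : ℂ)) hs hxC
    rwa [show C + δ = (∑ p ∈ T, (m p : ℝ) * Real.log p) / 2 + δ by rw [hCdef]] at this
  · rw [hnorm]; exact hNpos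
  · have hre := congrArg Complex.re hid
    rw [Complex.sub_re, Complex.ofReal_re, hn1, one_mul, Finset.sum_congr rfl fun p₀ _ ↦ hterm p₀] at hre
    rw [hre, hnorm, Finset.sum_neg_distrib, ← Finset.sum_mul, ← Finset.sum_coe_sort T (fun p ↦ Fc p)]
    ring

end Summit.RiemannHypothesis.RiemannHypothesis.Theorems.SemilocalDeletionProductCombsExist

end
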